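import Literature.NumberTheory.Transcendental.DeRhamTheoremProofs
import Literature.AlgebraicTopology.SingularHomology.HomologyRingChange
import Literature.AlgebraicTopology.SingularHomology.FundamentalClassProofs
import Literature.AlgebraicTopology.SingularHomology.OrientationProofs
import Literature.Geometry.Kaehler.ManifoldForms
import HarnessLib

/-!
# The homological symplectic orientation of a symplectic `4`-manifold, characterised by de Rham
# positivity `⟨[ω] ⌣ [ω], [N]⟩ > 0`

Topic `Literature/Geometry/Symplectic`. McDuff–Salamon, *Introduction to Symplectic Topology*
(3rd ed. 2017), §2.1 (after Cor. 2.1.4) and Def. 4.1.4: a symplectic form `ω` on a `2n`-manifold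
has `ωⁿ ≠ 0`, "a volume form, hence `M` is oriented"; §4.4 (proof of Thm. 13.3.11): "`[ω] ∪ [ω]`
is positive on the fundamental class", i.e. `∫_M ω ∧ ω > 0` in the symplectic orientation.  This
file names that orientation on the HOMOLOGICAL side of the tree, in a form that does not depend on
any choice of generator:

* `realClassOfClosedForm α hα hcl : Hᵏ(N; ℝ)` — the real singular class of a closed smooth
  `k`-form `α` on a manifold charted on `ℝⁿ`, the image of its de Rham class under the tree's
  integration isomorphism `integrationDeRhamIsoFamily` (de Rham's theorem, proved in
  `Literature/NumberTheory/Transcendental/DeRhamTheoremProofs.lean`: `[α] ↦ [σ ↦ ∫_σ α]`);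
* `realFundamentalClass μ : Hₙ(N; ℝ)` — the image of the fundamental class `[N]_μ ∈ Hₙ(N; ℤ)` of a
  `ℤ`-orientation under the change of coefficients `ℤ → ℝ` (`singularHomology.coeffChange`);
* `HomologicalOrientation.IsSymplecticOrientationOf μ s hs hcl` (`n = 4`) — **`μ` is the
  symplectic orientation of the closed `2`-form `s`**: `0 < ⟨[s] ⌣ [s], [N]_μ⟩`, the Kronecker
  pairing of the cup square of the real class of `s` with the real fundamental class of `μ`.

API: reversing `μ` reverses the sign of the pairing (`symplecticPairing_neg`, from the tree's
`fundamentalClass_neg_holds`), so `μ` and `-μ` are never both symplectic orientations of `s`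
(`IsSymplecticOrientationOf.not_neg`), and on a connected `N` a symplectic orientation of `s` is
unique (`IsSymplecticOrientationOf.unique`, from `eq_or_eq_neg_of_connected_holds`).

## Why a predicate on `HomologicalOrientation` and not the orientation `symplecticOrientation s`

`SymplecticOrientation.lean` constructs `symplecticOrientation s : HomologicalOrientation ℤ N 4`
from the (constructive) smooth orientation `sign Pf(s_y) · [e₀, …, e₃]` through the tree's bridge
`HomologicalOrientationOfSmooth.homologicalOrientationOfSmooth`
(`Literature/Topology/FourManifolds/IntersectionLatticeOrientationProofs.lean`).  That bridge rests
on the reference generator `gen0 n` of `Hₙ(ℝⁿ | 0; ℤ)`, which is `(genEquiv n).symm 1` for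
`genEquiv n := Classical.choice (localHomology.nonempty_linearEquiv ℤ 0)` (loc. cit., lines
136–141): an identification `Hₙ(ℝⁿ | 0; ℤ) ≃ ℤ` chosen by `Classical.choice`, of which nothing but
bijectivity and linearity is provable.  Consequently `symplecticOrientation s` is the symplectic
orientation of the books only up to a sign `εₙ ∈ {±1}` that no theorem of the tree can determine,
and a statement pairing a class built WITHOUT that choice (a Chern class, a de Rham class) against
`[N]_{symplecticOrientation s}` with an orientation-odd right-hand side — `b⁺(μ) ≥ 1`,
`⟨c₁², [N]_μ⟩ = 2χ + 3σ(μ)`, an adjunction formula — is neither provable nor refutable.  Such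
statements must instead quantify over `μ : HomologicalOrientation ℤ N 4` subject to
`μ.IsSymplecticOrientationOf s`, which is what the reduction of
`taubes_canonicalClass_symplecticCurve_four` (`TaubesCanonicalClassSymplecticCurveFourProofs.lean`)
does; the existence `∃ μ, μ.IsSymplecticOrientationOf s` for a closed symplectic `4`-manifold is
de Rham positivity `∫ ω ∧ ω > 0` read through the integration isomorphism (multiplicativity of
`integrationDeRhamIsoFamily` and evaluation of top-degree classes on `[N]`), not proved here.

## References

* D. McDuff, D. Salamon, *Introduction to Symplectic Topology*, 3rd ed., OUP (2017), §2.1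
  Cor. 2.1.4, Def. 4.1.4, §4.4. [McDuffSalamon2017]
* A. Hatcher, *Algebraic Topology* (2002), §2.2 p. 165 (change of coefficients), §3.3 p. 236
  (`[X]_{-μ} = -[X]_μ`), p. 241 (Kronecker pairing). [HatcherAT2002]
* G. de Rham (1931); G. E. Bredon, *Topology and Geometry* (1993), Thm. V.9.5. [Bredon1993]
-/

noncomputable section

open scoped Manifold ContDiff Topology
open Set Function
open Literature.Geometry.Kaehler (MForm IsSmoothForm IsClosedForm closedSmoothForms deRhamCohomology)
open Literature.AlgebraicTopology.SingularHomology Literature.NumberTheory.Transcendental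

namespace Literature.Geometry.Symplectic

/-- Local notation: `𝔼 n` is the model space `EuclideanSpace ℝ (Fin n)`. -/
local notation "𝔼" n:arg => EuclideanSpace ℝ (Fin n)

/-! ### The real singular class of a closed smooth form -/

section RealClass

variable {n : ℕ} {N : Type} [TopologicalSpace N] [ChartedSpace (𝔼 n) N] [IsManifold (𝓡 n) ∞ N]
  [T2Space N] [SigmaCompactSpace N] {k : ℕ}

/-- **The real singular cohomology class `[α] ∈ Hᵏ(N; ℝ)` of a closed smooth `k`-form** on a
manifold charted on `ℝⁿ`: its de Rham class `deRhamCohomology.mk ⟨α, _⟩` carried to singular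
cohomology by the integration isomorphism of de Rham's theorem (the tree's
`integrationDeRhamIsoFamily`, `[α] ↦ [σ ↦ ∫_σ α]`; Bredon 1993, Thm. V.9.5).
[cite: Bredon1993, Thm. V.9.5] -/
def realClassOfClosedForm (α : MForm (𝓡 n) N ℝ k) (hα : IsSmoothForm α) (hcl : IsClosedForm α) :
    singularCohomology ℝ ℝ N k :=
  integrationDeRhamIsoFamily (𝔼 n) N k (deRhamCohomology.mk ⟨α, hα, hcl⟩)

/-- Unfolding `realClassOfClosedForm`. [folklore] -/
theorem realClassOfClosedForm_eq (α : MForm (𝓡 n) N ℝ k) (hα : IsSmoothForm α)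
    (hcl : IsClosedForm α) :
    realClassOfClosedForm α hα hcl =
      integrationDeRhamIsoFamily (𝔼 n) N k (deRhamCohomology.mk ⟨α, hα, hcl⟩) :=
  rfl

/-- The real class is additive in the form: `[α + β] = [α] + [β]`. [folklore] -/
theorem realClassOfClosedForm_add (α β : MForm (𝓡 n) N ℝ k) (hα : IsSmoothForm α)
    (hαc : IsClosedForm α) (hβ : IsSmoothForm β) (hβc : IsClosedForm β) :
    realClassOfClosedForm (α + β) ((closedSmoothForms (𝓡 n) N ℝ k).add_mem ⟨hα, hαc⟩ ⟨hβ, hβc⟩).1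
        ((closedSmoothForms (𝓡 n) N ℝ k).add_mem ⟨hα, hαc⟩ ⟨hβ, hβc⟩).2 =
      realClassOfClosedForm α hα hαc + realClassOfClosedForm β hβ hβc := by
  simp only [realClassOfClosedForm, ← map_add]
  rfl

/-- The real class is homogeneous in the form: `[c • α] = c • [α]`. [folklore] -/
theorem realClassOfClosedForm_smul (c : ℝ) (α : MForm (𝓡 n) N ℝ k) (hα : IsSmoothForm α)
    (hαc : IsClosedForm α) :
    realClassOfClosedForm (c • α) ((closedSmoothForms (𝓡 n) N ℝ k).smul_mem c ⟨hα, hαc⟩).1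
        ((closedSmoothForms (𝓡 n) N ℝ k).smul_mem c ⟨hα, hαc⟩).2 =
      c • realClassOfClosedForm α hα hαc := by
  simp only [realClassOfClosedForm, ← map_smul]
  rfl

end RealClass

/-! ### The real fundamental class of a `ℤ`-orientation -/

section RealFundamentalClass

variable {n : ℕ} {N : Type} [TopologicalSpace N]

/-- **The real fundamental class `[N]_μ ∈ Hₙ(N; ℝ)` of a `ℤ`-orientation**: the image of the
integral fundamental class `μ.fundamentalClass ∈ Hₙ(N; ℤ)` under the change of coefficients
`ℤ → ℝ` (Hatcher 2002, §2.2 p. 165, the tree's `singularHomology.coeffChange`).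
[cite: HatcherAT2002, §2.2 p. 165] -/
def realFundamentalClass (μ : HomologicalOrientation ℤ N n) : singularHomology ℝ ℝ N n :=
  singularHomology.coeffChange N (Int.castAddHom ℝ) n μ.fundamentalClass

/-- Unfolding `realFundamentalClass`. [folklore] -/
theorem realFundamentalClass_eq (μ : HomologicalOrientation ℤ N n) :
    realFundamentalClass μ =
      singularHomology.coeffChange N (Int.castAddHom ℝ) n μ.fundamentalClass :=
  rfl

/-- **`[N]_{-μ} = -[N]_μ` over `ℝ`** (Hatcher 2002, §3.3 p. 236; the tree's
`fundamentalClass_neg_holds` pushed through the change of coefficients).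
[cite: HatcherAT2002, §3.3 p. 236] -/
theorem realFundamentalClass_neg [CompactSpace N] [T2Space N] [ChartedSpace (𝔼 n) N]
    (μ : HomologicalOrientation ℤ N n) :
    realFundamentalClass (-μ) = -realFundamentalClass μ := by
  rw [realFundamentalClass, realFundamentalClass,
    HomologicalOrientation.fundamentalClass_neg_holds (R := ℤ) (X := N) n μ, map_neg]

end RealFundamentalClass

/-! ### The symplectic orientation of a closed `2`-form on a `4`-manifold -/

section Four

variable {N : Type} [TopologicalSpace N] [ChartedSpace (𝔼 4) N] [IsManifold (𝓡 4) ∞ N]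
  [T2Space N] [SigmaCompactSpace N]

/-- **The de Rham pairing `⟨[s] ⌣ [s], [N]_μ⟩ ∈ ℝ`** of a closed smooth `2`-form `s` on a
`4`-manifold against a `ℤ`-orientation `μ` (for a closed symplectic manifold and its symplectic
orientation this is `∫_N s ∧ s`; McDuff–Salamon 2017, §4.4). [cite: McDuffSalamon2017, §4.4] -/
def symplecticPairing (μ : HomologicalOrientation ℤ N 4) (s : MForm (𝓡 4) N ℝ 2)
    (hs : IsSmoothForm s) (hcl : IsClosedForm s) : ℝ :=
  kroneckerPairing ℝ ℝ N 4
    (cupProduct two_add_two_eq_four (realClassOfClosedForm s hs hcl) (realClassOfClosedForm s hs hcl))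
    (realFundamentalClass μ)

/-- Unfolding `symplecticPairing`. [folklore] -/
theorem symplecticPairing_eq (μ : HomologicalOrientation ℤ N 4) (s : MForm (𝓡 4) N ℝ 2)
    (hs : IsSmoothForm s) (hcl : IsClosedForm s) :
    symplecticPairing μ s hs hcl =
      kroneckerPairing ℝ ℝ N 4
        (cupProduct two_add_two_eq_four (realClassOfClosedForm s hs hcl)
          (realClassOfClosedForm s hs hcl))
        (realFundamentalClass μ) :=
  rfl

/-- **Reversing the orientation reverses the pairing**: `⟨[s]², [N]_{-μ}⟩ = -⟨[s]², [N]_μ⟩`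
(Hatcher 2002, §3.3 p. 236). [cite: HatcherAT2002, §3.3 p. 236] -/
theorem symplecticPairing_neg [CompactSpace N] (μ : HomologicalOrientation ℤ N 4)
    (s : MForm (𝓡 4) N ℝ 2) (hs : IsSmoothForm s) (hcl : IsClosedForm s) :
    symplecticPairing (-μ) s hs hcl = -symplecticPairing μ s hs hcl := by
  rw [symplecticPairing, symplecticPairing, realFundamentalClass_neg, map_neg]

/-- **`μ` is the symplectic orientation of the closed `2`-form `s`** on the `4`-manifold `N`:
the cup square of the real class `[s] ∈ H²(N; ℝ)` pairs POSITIVELY with the real fundamental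
class of `μ`, `0 < ⟨[s] ⌣ [s], [N]_μ⟩` — McDuff–Salamon 2017, §2.1 / Def. 4.1.4 (`ω ∧ ω` is a
volume form and orients `M`) and §4.4 (`[ω]²` is positive on the fundamental class of the
symplectic orientation).  A predicate on homological orientations, insensitive to any choice of
generator of local homology (module docstring). [cite: McDuffSalamon2017, Def. 4.1.4 and §4.4] -/
def _root_.Literature.AlgebraicTopology.SingularHomology.HomologicalOrientation.IsSymplecticOrientationOf
    (μ : HomologicalOrientation ℤ N 4) (s : MForm (𝓡 4) N ℝ 2) (hs : IsSmoothForm s)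
    (hcl : IsClosedForm s) : Prop :=
  0 < symplecticPairing μ s hs hcl

/-- Unfolding `IsSymplecticOrientationOf`. [folklore] -/
theorem isSymplecticOrientationOf_iff (μ : HomologicalOrientation ℤ N 4) (s : MForm (𝓡 4) N ℝ 2)
    (hs : IsSmoothForm s) (hcl : IsClosedForm s) :
    μ.IsSymplecticOrientationOf s hs hcl ↔ 0 < symplecticPairing μ s hs hcl :=
  Iff.rfl

/-- `-μ` is the symplectic orientation of `s` iff `⟨[s]², [N]_μ⟩ < 0`. [cite: HatcherAT2002, §3.3 p. 236] -/
theorem isSymplecticOrientationOf_neg_iff [CompactSpace N] (μ : HomologicalOrientation ℤ N 4)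
    (s : MForm (𝓡 4) N ℝ 2) (hs : IsSmoothForm s) (hcl : IsClosedForm s) :
    (-μ).IsSymplecticOrientationOf s hs hcl ↔ symplecticPairing μ s hs hcl < 0 := by
  rw [isSymplecticOrientationOf_iff, symplecticPairing_neg, neg_pos]

/-- **An orientation and its reverse are not both symplectic orientations of `s`.** [folklore] -/
theorem _root_.Literature.AlgebraicTopology.SingularHomology.HomologicalOrientation.IsSymplecticOrientationOf.not_neg
    [CompactSpace N] {μ : HomologicalOrientation ℤ N 4} {s : MForm (𝓡 4) N ℝ 2}
    {hs : IsSmoothForm s} {hcl : IsClosedForm s} (h : μ.IsSymplecticOrientationOf s hs hcl) :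
    ¬ (-μ).IsSymplecticOrientationOf s hs hcl := by
  rw [isSymplecticOrientationOf_neg_iff]
  exact not_lt.2 h.le

/-- **Uniqueness of the symplectic orientation on a connected manifold**: two symplectic
orientations of the same closed `2`-form coincide (a connected manifold has exactly the two
orientations `ν`, `-ν`, Hatcher 2002 §3.3 p. 234, the tree's `eq_or_eq_neg_of_connected_holds`;
and `-ν` is excluded by `not_neg`). [cite: HatcherAT2002, §3.3 p. 234] -/
theorem _root_.Literature.AlgebraicTopology.SingularHomology.HomologicalOrientation.IsSymplecticOrientationOf.unique
    [CompactSpace N] [ConnectedSpace N] {μ ν : HomologicalOrientation ℤ N 4}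
    {s : MForm (𝓡 4) N ℝ 2} {hs : IsSmoothForm s} {hcl : IsClosedForm s}
    (hμ : μ.IsSymplecticOrientationOf s hs hcl) (hν : ν.IsSymplecticOrientationOf s hs hcl) :
    μ = ν := by
  rcases HomologicalOrientation.eq_or_eq_neg_of_connected_holds N μ ν with h | h
  · exact h
  · subst h
    exact absurd hμ hν.not_neg

end Four

end Literature.Geometry.Symplectic

end
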